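import Summits.CriticalPhenomena.PercolationContinuityZ3.Theorems.PercNearOneGluingNearOneGluingQ7ThreeCutAux

/-!
# Crux `PercNearOneGluing.NearOneGluing` (stmt-CriticalPhenomena-4574), line `SketchR2I5` —
# Kozma–Nitzan Question 7 for THREE relays, part III: `(R3)` from `(R3″)`

Lead prover-line-stmt-CriticalPhenomena-4574-c6 (cycle 6).  Lands `--supports stmt-CriticalPhenomena-4574`;
no definitions, no named facts.

Finite weighted graph on `Fin n` (`μ = prodBernoulli w`), source `o`, target `b`, relays `x, y, z`.  Write
`D = {x ↮ y} ∩ {x ↮ z}`, `W = D ∩ {o ↔ x}`,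
`λ = μ({o↔y} ∩ ({y↔b} ∖ {z↔b})) − μ({o↔y} ∩ ({z↔b} ∖ {y↔b}))`,
`L = μ({x↔y} ∩ ({y↔b} ∖ {z↔b})) − μ({x↔y} ∩ ({z↔b} ∖ {y↔b}))`,
`Φ = μ(D ∩ {x↔b}) − μ(D ∩ {z↔b})`.
The inequality `(R3)  0 ≤ μ(D)·λ + μ(W)·Φ` feeds `q7Three_of_R3` (tree file `…Q7ThreeCut`).  Here we prove the
elementary reduction of `(R3)` to `(R3″)  μ(W)·L ≤ μ(D)·λ` under `μ(z↔b) ≤ μ(x↔b)`: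

* `r3_key_identity`: `Φ + L = μ(x↔b) − μ(z↔b)` (split `Ω` into `{x↔y}`, `{x↮y} ∩ {x↔z}`, `D`; on the first
  piece `x↔b ⟺ y↔b`, on the second `x↔b ⟺ z↔b`);
* `r3_of_r3pp`: `(R3″)` and `μ(z↔b) ≤ μ(x↔b)` give `(R3)`, since
  `μ(D)·λ + μ(W)·Φ ≥ μ(W)·(L + Φ) = μ(W)·(μ(x↔b) − μ(z↔b)) ≥ 0`;
* the registered stub form `stub_r3OfR3pp`.
[cite: KozmaNitzan2024, Question 7 (p. 36)]
-/

namespace Summit.CriticalPhenomena.PercolationContinuityZ3.Theorems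

open MeasureTheory Set Literature.Probability.LatticeModels Literature.Probability.Percolation
open scoped Classical BigOperators
open Q7ThreeCut

noncomputable section

variable {n : ℕ}

namespace R3OfR3pp

/-- Splitting an event along another one on the finite configuration space (every set is measurable):
`μ(S) = μ(S ∩ T) + μ(S ∩ Tᶜ)`. [folklore] -/
theorem measureReal_split (μ : Measure (BondConfig (Fin n))) [IsFiniteMeasure μ]
    (S T : Set (BondConfig (Fin n))) : μ.real S = μ.real (S ∩ T) + μ.real (S ∩ Tᶜ) := by
  have h := measureReal_inter_add_sdiff (μ := μ) (s := S) (MeasurableSet.of_discrete : MeasurableSet T)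
  rw [Set.sdiff_eq] at h
  exact h.symm

end R3OfR3pp

open R3OfR3pp

/-! ### The key identity -/

/-- **The key identity `Φ + L = μ(x↔b) − μ(z↔b)`.**  With `D = {x ↮ y} ∩ {x ↮ z}`,
`[μ(D ∩ {x↔b}) − μ(D ∩ {z↔b})] + [μ({x↔y} ∩ ({y↔b} ∖ {z↔b})) − μ({x↔y} ∩ ({z↔b} ∖ {y↔b}))]
  = μ(x↔b) − μ(z↔b)`.
Proof: split `Ω` into the three disjoint pieces `{x↔y}`, `{x↮y} ∩ {x↔z}` and `D`.  On `{x↔y}` one has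
`x↔b ⟺ y↔b`, so the `{x↔y}`-parts of `μ(x↔b) − μ(z↔b)` are
`μ({x↔y} ∩ {y↔b}) − μ({x↔y} ∩ {z↔b}) = L` (split both along the other event); on `{x↮y} ∩ {x↔z}` one has
`x↔b ⟺ z↔b`, so these parts cancel; the `D`-parts give `Φ`. [cite: KozmaNitzan2024, Question 7 (p. 36)] -/
theorem r3_key_identity (w : Sym2 (Fin n) → unitInterval) (b x y z : Fin n) :
    ((prodBernoulli w).real (((openConn x y)ᶜ ∩ (openConn x z)ᶜ) ∩ openConn x b) -
        (prodBernoulli w).real (((openConn x y)ᶜ ∩ (openConn x z)ᶜ) ∩ openConn z b)) +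
      ((prodBernoulli w).real (openConn x y ∩ (openConn y b \ openConn z b)) -
        (prodBernoulli w).real (openConn x y ∩ (openConn z b \ openConn y b))) =
    (prodBernoulli w).real (openConn x b) - (prodBernoulli w).real (openConn z b) := by
  set μ := prodBernoulli w with hμ
  set A : Set (BondConfig (Fin n)) := openConn x y with hA
  set B : Set (BondConfig (Fin n)) := openConn x z with hB
  set XB : Set (BondConfig (Fin n)) := openConn x b with hXB
  set YB : Set (BondConfig (Fin n)) := openConn y b with hYB
  set ZB : Set (BondConfig (Fin n)) := openConn z b with hZB
  -- three-way splits of `{x↔b}` and `{z↔b}` along `A = {x↔y}` and `B = {x↔z}`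
  have ex1 : μ.real XB = μ.real (XB ∩ A) + μ.real (XB ∩ Aᶜ) := measureReal_split μ XB A
  have ex2 : μ.real (XB ∩ Aᶜ) = μ.real (XB ∩ Aᶜ ∩ B) + μ.real (XB ∩ Aᶜ ∩ Bᶜ) :=
    measureReal_split μ _ B
  have ez1 : μ.real ZB = μ.real (ZB ∩ A) + μ.real (ZB ∩ Aᶜ) := measureReal_split μ ZB A
  have ez2 : μ.real (ZB ∩ Aᶜ) = μ.real (ZB ∩ Aᶜ ∩ B) + μ.real (ZB ∩ Aᶜ ∩ Bᶜ) :=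
    measureReal_split μ _ B
  -- on `{x↔y}`: `{x↔b} ∩ {x↔y} = {x↔y} ∩ {y↔b}`
  have hXA : XB ∩ A = A ∩ YB := by
    ext ω
    constructor
    · rintro ⟨hxb, hxy⟩
      exact ⟨hxy, conn_trans (conn_symm hxy) hxb⟩
    · rintro ⟨hxy, hyb⟩
      exact ⟨conn_trans hxy hyb, hxy⟩
  have hZA : ZB ∩ A = A ∩ ZB := inter_comm _ _
  have ey1 : μ.real (A ∩ YB) = μ.real (A ∩ YB ∩ ZB) + μ.real (A ∩ YB ∩ ZBᶜ) :=
    measureReal_split μ _ ZB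
  have ey2 : μ.real (A ∩ ZB) = μ.real (A ∩ ZB ∩ YB) + μ.real (A ∩ ZB ∩ YBᶜ) :=
    measureReal_split μ _ YB
  have hABC : A ∩ ZB ∩ YB = A ∩ YB ∩ ZB := inter_right_comm _ _ _
  have hL1 : A ∩ YB ∩ ZBᶜ = A ∩ (YB \ ZB) := by rw [inter_assoc, Set.sdiff_eq]
  have hL2 : A ∩ ZB ∩ YBᶜ = A ∩ (ZB \ YB) := by rw [inter_assoc, Set.sdiff_eq]
  -- on `{x↮y} ∩ {x↔z}`: `x↔b ⟺ z↔b`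
  have hmid : XB ∩ Aᶜ ∩ B = ZB ∩ Aᶜ ∩ B := by
    ext ω
    constructor
    · rintro ⟨⟨hxb, hxy⟩, hxz⟩
      exact ⟨⟨conn_trans (conn_symm hxz) hxb, hxy⟩, hxz⟩
    · rintro ⟨⟨hzb, hxy⟩, hxz⟩
      exact ⟨⟨conn_trans hxz hzb, hxy⟩, hxz⟩
  -- on `D`
  have hDX : XB ∩ Aᶜ ∩ Bᶜ = (Aᶜ ∩ Bᶜ) ∩ XB := by rw [inter_assoc, inter_comm]
  have hDZ : ZB ∩ Aᶜ ∩ Bᶜ = (Aᶜ ∩ Bᶜ) ∩ ZB := by rw [inter_assoc, inter_comm]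
  rw [hXA] at ex1
  rw [hZA] at ez1
  rw [hmid, hDX] at ex2
  rw [hDZ] at ez2
  rw [hL1] at ey1
  rw [hABC, hL2] at ey2
  linarith

/-! ### `(R3)` from `(R3″)` -/

/-- **`(R3)` from `(R3″)` and `μ(z↔b) ≤ μ(x↔b)`.**  With `D = {x ↮ y} ∩ {x ↮ z}`, `W = D ∩ {o↔x}`,
`λ = μ({o↔y}∩({y↔b}∖{z↔b})) − μ({o↔y}∩({z↔b}∖{y↔b}))`, `L = μ({x↔y}∩({y↔b}∖{z↔b})) − μ({x↔y}∩({z↔b}∖{y↔b}))`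
and `Φ = μ(D∩{x↔b}) − μ(D∩{z↔b})`: if `μ(z↔b) ≤ μ(x↔b)` and `(R3″) μ(W)·L ≤ μ(D)·λ`, then
`(R3) 0 ≤ μ(D)·λ + μ(W)·Φ`.  Indeed `μ(D)·λ + μ(W)·Φ ≥ μ(W)·(L + Φ) = μ(W)·(μ(x↔b) − μ(z↔b)) ≥ 0` by
`r3_key_identity`. [cite: KozmaNitzan2024, Question 7 (p. 36)] -/
theorem r3_of_r3pp (w : Sym2 (Fin n) → unitInterval) (o b x y z : Fin n)
    (hzx : (prodBernoulli w).real (openConn z b) ≤ (prodBernoulli w).real (openConn x b))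
    (hR3pp : (prodBernoulli w).real (((openConn x y)ᶜ ∩ (openConn x z)ᶜ) ∩ openConn o x) *
        ((prodBernoulli w).real (openConn x y ∩ (openConn y b \ openConn z b)) -
          (prodBernoulli w).real (openConn x y ∩ (openConn z b \ openConn y b))) ≤
      (prodBernoulli w).real ((openConn x y)ᶜ ∩ (openConn x z)ᶜ) *
        ((prodBernoulli w).real (openConn o y ∩ (openConn y b \ openConn z b)) -
          (prodBernoulli w).real (openConn o y ∩ (openConn z b \ openConn y b)))) :
    0 ≤ (prodBernoulli w).real ((openConn x y)ᶜ ∩ (openConn x z)ᶜ) *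
        ((prodBernoulli w).real (openConn o y ∩ (openConn y b \ openConn z b)) -
          (prodBernoulli w).real (openConn o y ∩ (openConn z b \ openConn y b))) +
      (prodBernoulli w).real (((openConn x y)ᶜ ∩ (openConn x z)ᶜ) ∩ openConn o x) *
        ((prodBernoulli w).real (((openConn x y)ᶜ ∩ (openConn x z)ᶜ) ∩ openConn x b) -
          (prodBernoulli w).real (((openConn x y)ᶜ ∩ (openConn x z)ᶜ) ∩ openConn z b)) := by
  have hid := r3_key_identity w b x y z
  have h1 : 0 ≤ (prodBernoulli w).real (((openConn x y)ᶜ ∩ (openConn x z)ᶜ) ∩ openConn o x) *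
      ((prodBernoulli w).real (openConn x b) - (prodBernoulli w).real (openConn z b)) :=
    mul_nonneg measureReal_nonneg (sub_nonneg.2 hzx)
  rw [← hid, mul_add] at h1
  linarith

/-! ### Registered stub form (explicit `∀ n`, fully qualified) -/

/-- Registered stub form of `r3_of_r3pp` (`(R3)` from `(R3″)` and `μ(z↔b) ≤ μ(x↔b)`).
[cite: KozmaNitzan2024, Question 7 (p. 36)] -/
theorem stub_r3OfR3pp : ∀ (n : ℕ) (w : Sym2 (Fin n) → unitInterval) (o b x y z : Fin n), (Literature.Probability.LatticeModels.prodBernoulli w).real (Literature.Probability.Percolation.openConn z b) ≤ (Literature.Probability.LatticeModels.prodBernoulli w).real (Literature.Probability.Percolation.openConn x b) → (Literature.Probability.LatticeModels.prodBernoulli w).real (((Literature.Probability.Percolation.openConn x y)ᶜ ∩ (Literature.Probability.Percolation.openConn x z)ᶜ) ∩ Literature.Probability.Percolation.openConn o x) * ((Literature.Probability.LatticeModels.prodBernoulli w).real (Literature.Probability.Percolation.openConn x y ∩ (Literature.Probability.Percolation.openConn y b \ Literature.Probability.Percolation.openConn z b)) - (Literature.Probability.LatticeModels.prodBernoulli w).real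 (Literature.Probability.Percolation.openConn x y ∩ (Literature.Probability.Percolation.openConn z b \ Literature.Probability.Percolation.openConn y b))) ≤ (Literature.Probability.LatticeModels.prodBernoulli w).real ((Literature.Probability.Percolation.openConn x y)ᶜ ∩ (Literature.Probability.Percolation.openConn x z)ᶜ) * ((Literature.Probability.LatticeModels.prodBernoulli w).real (Literature.Probability.Percolation.openConn o y ∩ (Literature.Probability.Percolation.openConn y b \ Literature.Probability.Percolation.openConn z b)) - (Literature.Probability.LatticeModels.prodBernoulli w).real (Literature.Probability.Percolation.openConn o y ∩ (Literature.Probability.Percolation.openConn z b \ Literature.Probability.Percolation.openConn y b))) → 0 ≤ (Literature.Probability.LatticeModels.prodBernoulli w).real ((Literature.Probability.Percolation.openConn x y)ᶜ ∩ (Literature.Probability.Percolation.openConn x z)ᶜ) * ((Literature.Probability.LatticeModels.prodBernoulli w).real (Literature.Probability.Percolation.openConn o y ∩ (Literature.Probability.Percolation.openConn y b \ Literature.Probability.Percolation.openConn z b)) - (Literature.Probability.LatticeModels.prodBernoulli w).real (Literature.Probability.Percolation.openConn o y ∩ (Literature.Probability.Percolation.openConn z b \ Literature.Probability.Percolation.openConn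 y b))) + (Literature.Probability.LatticeModels.prodBernoulli w).real (((Literature.Probability.Percolation.openConn x y)ᶜ ∩ (Literature.Probability.Percolation.openConn x z)ᶜ) ∩ Literature.Probability.Percolation.openConn o x) * ((Literature.Probability.LatticeModels.prodBernoulli w).real (((Literature.Probability.Percolation.openConn x y)ᶜ ∩ (Literature.Probability.Percolation.openConn x z)ᶜ) ∩ Literature.Probability.Percolation.openConn x b) - (Literature.Probability.LatticeModels.prodBernoulli w).real (((Literature.Probability.Percolation.openConn x y)ᶜ ∩ (Literature.Probability.Percolation.openConn x z)ᶜ) ∩ Literature.Probability.Percolation.openConn z b)) :=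
  fun _ w o b x y z hzx h => r3_of_r3pp w o b x y z hzx h

end

end Summit.CriticalPhenomena.PercolationContinuityZ3.Theorems
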